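import Summits.KontsevichZagierPeriods.KontsevichZagierPeriods.Theses.TorsionLogs
import Summits.KontsevichZagierPeriods.KontsevichZagierPeriods.Theorems.TorsionLogsNeronTorsionSector
import Summits.KontsevichZagierPeriods.KontsevichZagierPeriods.Theorems.TorsionLogsNeronTorsionSectorStubRealDictionary
import Literature.NumberTheory.Transcendental.KZKernelConjectureForms
import Literature.NumberTheory.Transcendental.KZProductIdeal

/-!
# Crux `TorsionSectorComplete` (stmt-KontsevichZagierPeriods-14212) — line `NeronHaar`
# (forward generator G1 `next-rung` over the floor `NeronTorsionPrimitiveChain`, unit fwd2-rung-KontsevichZagierPeriods-01, gen 20)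

Route `TorsionLogs` (route-KontsevichZagierPeriods-TorsionLogs; `closes (h₁ : NeronTorsionSector)
(h₂ : TorsionSectorComplete) : KontsevichZagierPeriods`; `h₁` CLOSED by the landed translation chain, `h₂` the open
residual).

FLOOR (seed g1-KontsevichZagierPeriods-17981, CLOSED): `Theses.TorsionLogs.NeronTorsionPrimitiveChain` — the Néron–torsion
chain `q²•[rI] + p²•[rP] − c•[rB] ∈ KZ.relations` AT A REAL `N`-TORSION POINT `P` of the identity component `γ` of
`y² = f(x) = 4x³ − g₂x − g₃`: the triangle `[rI] = [e₁<x₁<x₀<x_P, x₁dx₁dx₀/(√f√f)]` (the regularised Néron integral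
`I(P)`), the quadrant `η₁·ω₁/2`, a log carrier; in value `I(P) = −(p/q)²·η₁ω₁/2 + (c/q²)·log B`.

ONE MOVE — THE EVALUATION FUNCTIONAL: `δ_P` (a torsion point of exact order `N`) ↦ THE HAAR PROBABILITY MEASURE `du/ω₁`
OF `γ = E⁰(ℝ)` (the weak limit `N → ∞` of the Néron–torsion packets `(1/N)∑ₖ δ_{kP}`).  Integrating the triangle
against Haar measure closes it up into the COMPLETE LENGTH-THREE INTEGRAL
  `L₃(O) = ∫_γ I dμ·(ω₁/2) = [r3O] = [e₁<z₂<z₁<z₀, z₂ dz₂dz₁dz₀/(√f(z₂)√f(z₁)√f(z₀))]`   (absolutely convergent),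
and the torsion arithmetic `(p/q)² = ((N−2a)/2N)²` averages to the second Bernoulli moment; but the Haar mean of the
Néron function on `γ` is NOT log-algebraic: it is `−(1/12)·log|q_τ| = (π/6)·Im(ω₂/ω₁)` (the archimedean local height
pairing of `γ` with itself).  The new member is therefore the TIED HAAR SECTOR STATEMENT `NeronHaarSector`: with
  `rEta = [(e₁,∞), (g₂t+2g₃)/(2t²√f)] = η₁`,  `rA = [(e₁,∞), 1/√f] = ω₁/2`,
  `rN = [{t : f(t) < 0}, 1/√(−f)] = W := Im ω₂`  (the real locus where `f < 0`: `(−∞,e₃) ∪ (e₂,e₁)` if `Δ > 0`, `(−∞,e₁)`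
        if `Δ < 0`; in both cases its `dx/√(−f)`-length is the imaginary part of the second period, `Re ω₂ ∈ {0, ω₁/2}`),
  `[π] = KZ.piRep`,  `rB = [1<t<B, 1/t] = log B`,
every integer `c` with (in value) `12·r3O + rEta·rA·rA − π·rN − c·(rA·rB) = 0` gives
`12•[r3O] + [rEta][rA][rA] − [π][rN] − c•([rA][rB]) ∈ KZ.relations`.
TRUE INSTANCE (Néron function `λ̃ = −log|σ| + (η₁/2ω₁)u²`, `I(X(u)) = λ̃(u) − λ̃(ω₁/2) − (η₁/2ω₁)(ω₁/2 − u)²`,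
`λ̃(ω₁/2) = ¼·log D`, `D = f′(e₁)/4 = 3e₁² − g₂/4`, and the Haar mean `∫₀^{ω₁} log|σ̃| du/ω₁ = (1/12)log|Δ| + (1/12)log|q|`
by the product formula for `σ` + Jensen):
  `48·L₃(O) + η₁ω₁² + 6ω₁·log D − 2ω₁·log|Δ| = 4π·W`,   i.e.  `c·log B = log(|Δ|/D³)` with `Δ = g₂³ − 27g₃²`;
numerically certified on 9 curves (both signs of `Δ`, incl. `g₃ = 0` and `g₂ = 0`; absolute residual ≤ 6.3e-12; seat
folder `num/haar.py`, `num/tail.py`, table in the line card).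

FAMILY (honest containment): `NeronHaarMember : Bool → Prop`, `false ↦` the floor decl VERBATIM, `true ↦`
`NeronHaarSector`; THE RUNG `NeronTorsionHaar := ∀ b, NeronHaarMember b`.  The family is indexed by the functional
against which the Néron triangle is evaluated (`δ_P`, `P` torsion ↦ Haar), nothing else varies.

SKELETON (3 registered stubs → the crux BY NAME):
* `stub_haarChainPos : HaarPrimitiveChainPos` (XL) — the primitive (∃-form) Haar chain for `Δ > 0` (two real
  components).  PLAN: (D) the π-free DESCENT IDENTITY `48·L₃(O) + 96·I_egg(ωωη) + 3η₁ω₁² = 6ω₁·log(16(e₁−e₃)/(e₁−e₂))`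
  (= the `[2]`-distribution relation of the Néron function integrated against Haar measure: `[2]⁻¹γ ∩ E(ℝ) = γ ⊔ egg`,
  each sheet 2:1; route-native translation/multiplication technology on the total space `γ × cells`), MINUS (E) the
  egg identity `48·I_egg(ωωη) + η₁ω₁² + 2π·W = (ω₁/2)(16log2 + 8log(e₁−e₃) − 4log(e₁−e₂) − 4log(e₂−e₃))`, which is
  the open crux `Theses.GenusOneIterated.DepthThreeFamily` transported to Weierstrass carriers; integrally
  `(H) = (D) − (E)` (checked: `|Δ|/D³ = 16(e₂−e₃)²/((e₁−e₂)(e₁−e₃))`).  Direct alternative for the π-term: Stokes for the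
  length-three integrand on the lower half `x`-plane (boundary `(e₁,∞) ∪ (e₃,e₂) ∪ (e₂,e₁) ∪ (−∞,e₃)`) + `W·`Legendre.
* `stub_haarChainNeg : HaarPrimitiveChainNeg` (XL, hardest) — the same for `Δ < 0` (one real component, rhombic
  lattice, no oval): Stokes on the slit plane `ℂ ∖ ([e₁,∞) ∪ [ē,e])` with complex-conjugate cut.
* `stub_haarSectorComplete : HaarSectorComplete` (residual, conjecture-grade) — completeness modulo
  `relations ⊔ closure (T ∪ T_Haar)`; WEAKER than the crux.
Proved here (no `sorry`): the tied member from the two primitive chains (`haarSector_of_primitiveChains`: sign split,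
soundness, `ω₁ > 0` from the landed real dictionary, the landed log calculus, the left-ideal property of `relations`),
the rung, `closure T_Haar ≤ relations`, `closure T ≤ relations`, the F4 on-path theorem, and `TorsionSectorComplete_of`.
-/

noncomputable section

open Set MeasureTheory Filter Topology
open Literature.NumberTheory.Transcendental Literature.ModelTheory.ExponentialFields
open Summit.KontsevichZagierPeriods.KontsevichZagierPeriods.Theses.TorsionLogs (NeronTorsionSector NeronTorsionPrimitiveChain
  NeronTorsionPrimitiveChain_holds TorsionSectorComplete)
open Summit.KontsevichZagierPeriods.HyperbolicBloch.OffTetraSectorKernel (interval_log_relation_mem_relations)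
open Summit.KontsevichZagierPeriods.KontsevichZagierPeriods.Cruxes.NeronTorsionSector.Translation (logRep_value
  isAlgebraic_of_logRep NeronTorsionSector_of stub_realDictionary)

-- `Summit.KontsevichZagierPeriods.KontsevichZagierPeriods.…` is the tree's mandated layout (single-conjunct summit).
set_option linter.dupNamespace false

namespace Summit.KontsevichZagierPeriods.KontsevichZagierPeriods.Cruxes.TorsionSectorComplete.NeronHaar

/-! ### Statements -/

/-- **Member `true`: the TIED HAAR SECTOR STATEMENT.**  For the floor's curve data verbatim (real cubic
`f = 4x³ − g₂x − g₃`, `g₂³ ≠ 27g₃²`, largest root `e₁ > 0`, `f > 0` beyond) and representations pinned as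
`r3O = [e₁<z₂<z₁<z₀, z₂/(√f√f√f)]` (`= L₃(O)`), `rEta = [(e₁,∞), (g₂t+2g₃)/(2t²√f)]` (`= η₁`), `rA = [(e₁,∞), 1/√f]`
(`= ω₁/2`), `rN = [{f < 0}, 1/√(−f)]` (`= Im ω₂`), `rB = [1<t<B, 1/t]` (`B > 1`), `[π] = KZ.piRep`, every integer `c`
satisfying the VALUE HYPOTHESIS gives an element of `KZ.relations`.
[cite: KontsevichZagier2001, §1.2] [cite: SilvermanATAEC1994, VI Thm 3.4, VI Thm 4.2] [cite: Lang1983, Ch. 13] -/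
def NeronHaarSector : Prop :=
  ∀ (g₂ g₃ e₁ B : ℝ) (c : ℤ) (f : ℝ → ℝ),
    (∀ x, f x = 4 * x ^ 3 - g₂ * x - g₃) → g₂ ^ 3 - 27 * g₃ ^ 2 ≠ 0 → f e₁ = 0 → 0 < e₁ →
    (∀ x, e₁ < x → 0 < f x) → 1 < B →
    ∀ (r3O : KZ.IntegralRep 3) (rEta rA rN rB : KZ.IntegralRep 1),
    r3O.domain = {z | e₁ < z 2 ∧ z 2 < z 1 ∧ z 1 < z 0} →
    Set.EqOn r3O.integrand
      (fun z => z 2 / (Real.sqrt (f (z 2)) * Real.sqrt (f (z 1)) * Real.sqrt (f (z 0)))) r3O.domain →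
    rEta.domain = {t | e₁ < t 0} →
    Set.EqOn rEta.integrand (fun t => (g₂ * t 0 + 2 * g₃) / (2 * (t 0) ^ 2 * Real.sqrt (f (t 0)))) rEta.domain →
    rA.domain = {t | e₁ < t 0} → Set.EqOn rA.integrand (fun t => (Real.sqrt (f (t 0)))⁻¹) rA.domain →
    rN.domain = {t | f (t 0) < 0} → Set.EqOn rN.integrand (fun t => (Real.sqrt (-f (t 0)))⁻¹) rN.domain →
    rB.domain = {t | 1 < t 0 ∧ t 0 < B} → Set.EqOn rB.integrand (fun t => (t 0)⁻¹) rB.domain →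
    12 * r3O.value + rEta.value * rA.value * rA.value - Real.pi * rN.value - c * (rA.value * rB.value) = 0 →
    (12 : ℤ) • KZ.of r3O + KZ.of rEta * KZ.of rA * KZ.of rA - KZ.of KZ.piRep * KZ.of rN
      - c • (KZ.of rA * KZ.of rB) ∈ KZ.relations

/-- **The family, indexed by the functional (`false` ↦ evaluation at a torsion point, `true` ↦ Haar measure).**
Member `false` is the floor decl `Theses.TorsionLogs.NeronTorsionPrimitiveChain` VERBATIM (the seed, CLOSED); member
`true` is `NeronHaarSector`. Honest containment: nothing else varies. -/
def NeronHaarMember : Bool → Prop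
  | false => NeronTorsionPrimitiveChain
  | true => NeronHaarSector

/-- **THE RUNG `NeronTorsionHaar`: the torsion packets and their Haar limit.** -/
def NeronTorsionHaar : Prop := ∀ b : Bool, NeronHaarMember b

/-- **Stub P statement (XL): the PRIMITIVE HAAR CHAIN, two real components (`Δ > 0`).**  Same data and pinned
representations as the tied member with `0 < g₂³ − 27g₃²`, no `B`/`rB`/`c`/value hypothesis: there EXIST an integer
`c`, an algebraic `B > 1` and a log carrier with the Haar element in `KZ.relations`.  Plan: descent identity (D) minus
the egg identity (E) (= `GenusOneIterated.DepthThreeFamily` in Weierstrass carriers), see the module docstring.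
[cite: KontsevichZagier2001, §1.2] [cite: SilvermanATAEC1994, VI Thm 3.4] [cite: Lang1983, Ch. 13 Thm 1.1] -/
def HaarPrimitiveChainPos : Prop :=
  ∀ (g₂ g₃ e₁ : ℝ) (f : ℝ → ℝ),
    (∀ x, f x = 4 * x ^ 3 - g₂ * x - g₃) → 0 < g₂ ^ 3 - 27 * g₃ ^ 2 → f e₁ = 0 → 0 < e₁ →
    (∀ x, e₁ < x → 0 < f x) →
    ∀ (r3O : KZ.IntegralRep 3) (rEta rA rN : KZ.IntegralRep 1),
    r3O.domain = {z | e₁ < z 2 ∧ z 2 < z 1 ∧ z 1 < z 0} →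
    Set.EqOn r3O.integrand
      (fun z => z 2 / (Real.sqrt (f (z 2)) * Real.sqrt (f (z 1)) * Real.sqrt (f (z 0)))) r3O.domain →
    rEta.domain = {t | e₁ < t 0} →
    Set.EqOn rEta.integrand (fun t => (g₂ * t 0 + 2 * g₃) / (2 * (t 0) ^ 2 * Real.sqrt (f (t 0)))) rEta.domain →
    rA.domain = {t | e₁ < t 0} → Set.EqOn rA.integrand (fun t => (Real.sqrt (f (t 0)))⁻¹) rA.domain →
    rN.domain = {t | f (t 0) < 0} → Set.EqOn rN.integrand (fun t => (Real.sqrt (-f (t 0)))⁻¹) rN.domain →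
    ∃ (c : ℤ) (B : ℝ) (rB : KZ.IntegralRep 1), 1 < B ∧ IsAlgebraic ℚ B ∧
      rB.domain = {t | 1 < t 0 ∧ t 0 < B} ∧ Set.EqOn rB.integrand (fun t => (t 0)⁻¹) rB.domain ∧
      (12 : ℤ) • KZ.of r3O + KZ.of rEta * KZ.of rA * KZ.of rA - KZ.of KZ.piRep * KZ.of rN
        - c • (KZ.of rA * KZ.of rB) ∈ KZ.relations

/-- **Stub N statement (XL, hardest): the PRIMITIVE HAAR CHAIN, one real component (`Δ < 0`).**  As stub P with
`g₂³ − 27g₃² < 0` (rhombic period lattice, `E(ℝ) = γ` connected, no oval, `Re ω₂ = ω₁/2`).  Plan: Stokes for the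
length-three integrand on the slit plane `ℂ ∖ ([e₁,∞) ∪ [ē,e])`, `W·`Legendre on the cut.
[cite: KontsevichZagier2001, §1.2] [cite: SilvermanATAEC1994, VI Thm 3.4] -/
def HaarPrimitiveChainNeg : Prop :=
  ∀ (g₂ g₃ e₁ : ℝ) (f : ℝ → ℝ),
    (∀ x, f x = 4 * x ^ 3 - g₂ * x - g₃) → g₂ ^ 3 - 27 * g₃ ^ 2 < 0 → f e₁ = 0 → 0 < e₁ →
    (∀ x, e₁ < x → 0 < f x) →
    ∀ (r3O : KZ.IntegralRep 3) (rEta rA rN : KZ.IntegralRep 1),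
    r3O.domain = {z | e₁ < z 2 ∧ z 2 < z 1 ∧ z 1 < z 0} →
    Set.EqOn r3O.integrand
      (fun z => z 2 / (Real.sqrt (f (z 2)) * Real.sqrt (f (z 1)) * Real.sqrt (f (z 0)))) r3O.domain →
    rEta.domain = {t | e₁ < t 0} →
    Set.EqOn rEta.integrand (fun t => (g₂ * t 0 + 2 * g₃) / (2 * (t 0) ^ 2 * Real.sqrt (f (t 0)))) rEta.domain →
    rA.domain = {t | e₁ < t 0} → Set.EqOn rA.integrand (fun t => (Real.sqrt (f (t 0)))⁻¹) rA.domain →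
    rN.domain = {t | f (t 0) < 0} → Set.EqOn rN.integrand (fun t => (Real.sqrt (-f (t 0)))⁻¹) rN.domain →
    ∃ (c : ℤ) (B : ℝ) (rB : KZ.IntegralRep 1), 1 < B ∧ IsAlgebraic ℚ B ∧
      rB.domain = {t | 1 < t 0 ∧ t 0 < B} ∧ Set.EqOn rB.integrand (fun t => (t 0)⁻¹) rB.domain ∧
      (12 : ℤ) • KZ.of r3O + KZ.of rEta * KZ.of rA * KZ.of rA - KZ.of KZ.piRep * KZ.of rN
        - c • (KZ.of rA * KZ.of rB) ∈ KZ.relations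

/-- The identity-component tied set `T` of the crux `TorsionSectorComplete` (copied verbatim). -/
def TorsionTied : Set Literature.NumberTheory.Transcendental.KZ.FormalRep := {d : Literature.NumberTheory.Transcendental.KZ.FormalRep | ∃ (g₂ g₃ e₁ xP yP α : ℝ) (N a : ℕ) (M k m : ℤ) (f : ℝ → ℝ) (rI rP : Literature.NumberTheory.Transcendental.KZ.IntegralRep 2) (rL : Literature.NumberTheory.Transcendental.KZ.IntegralRep 1), (∀ x, f x = 4 * x ^ 3 - g₂ * x - g₃) ∧ g₂ ^ 3 - 27 * g₃ ^ 2 ≠ 0 ∧ f e₁ = 0 ∧ 0 < e₁ ∧ (∀ x, e₁ < x → 0 < f x) ∧ e₁ < xP ∧ yP ^ 2 = f xP ∧ 3 ≤ N ∧ 0 < a ∧ 2 * a < N ∧ 4 * (N : ℤ) ^ 2 * k = M * ((N : ℤ) - 2 * (a : ℤ)) ^ 2 ∧ (∀ hns : (⟨0, 0, 0, -g₂ / 4, -g₃ / 4⟩ : WeierstrassCurve ℝ).toAffine.Nonsingular xP (yP / 2), addOrderOf (WeierstrassCurve.Affine.Point.some xP (yP / 2) hns) = N) ∧ (N : ℝ)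 * (∫ x in Set.Ioi xP, (Real.sqrt (f x))⁻¹) = a * (2 * ∫ x in Set.Ioi e₁, (Real.sqrt (f x))⁻¹) ∧ 1 < α ∧ rI.domain = {z | e₁ < z 1 ∧ z 1 < z 0 ∧ z 0 < xP} ∧ Set.EqOn rI.integrand (fun z => z 1 / (Real.sqrt (f (z 1)) * Real.sqrt (f (z 0)))) rI.domain ∧ rP.domain = {z | e₁ < z 0 ∧ e₁ < z 1} ∧ Set.EqOn rP.integrand (fun z => (Real.sqrt (f (z 0)))⁻¹ * ((g₂ * z 1 + 2 * g₃) / (2 * (z 1) ^ 2 * Real.sqrt (f (z 1))))) rP.domain ∧ rL.domain = {t | 1 < t 0 ∧ t 0 < α} ∧ Set.EqOn rL.integrand (fun t => (t 0)⁻¹) rL.domain ∧ (M : ℝ) * rI.value + k * rP.value = m * rL.value ∧ d = M • Literature.NumberTheory.Transcendental.KZ.of rI + k • Literature.NumberTheory.Transcendental.KZ.of rP - m • Literature.NumberTheory.Transcendental.KZ.of rL}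

/-- The tied HAAR set `T_Haar`: the elements of the member `true`, with their value hypothesis. -/
def HaarTied : Set Literature.NumberTheory.Transcendental.KZ.FormalRep :=
  {d | ∃ (g₂ g₃ e₁ B : ℝ) (c : ℤ) (f : ℝ → ℝ) (r3O : KZ.IntegralRep 3) (rEta rA rN rB : KZ.IntegralRep 1),
    (∀ x, f x = 4 * x ^ 3 - g₂ * x - g₃) ∧ g₂ ^ 3 - 27 * g₃ ^ 2 ≠ 0 ∧ f e₁ = 0 ∧ 0 < e₁ ∧
    (∀ x, e₁ < x → 0 < f x) ∧ 1 < B ∧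
    r3O.domain = {z | e₁ < z 2 ∧ z 2 < z 1 ∧ z 1 < z 0} ∧
    Set.EqOn r3O.integrand
      (fun z => z 2 / (Real.sqrt (f (z 2)) * Real.sqrt (f (z 1)) * Real.sqrt (f (z 0)))) r3O.domain ∧
    rEta.domain = {t | e₁ < t 0} ∧
    Set.EqOn rEta.integrand (fun t => (g₂ * t 0 + 2 * g₃) / (2 * (t 0) ^ 2 * Real.sqrt (f (t 0)))) rEta.domain ∧
    rA.domain = {t | e₁ < t 0} ∧ Set.EqOn rA.integrand (fun t => (Real.sqrt (f (t 0)))⁻¹) rA.domain ∧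
    rN.domain = {t | f (t 0) < 0} ∧ Set.EqOn rN.integrand (fun t => (Real.sqrt (-f (t 0)))⁻¹) rN.domain ∧
    rB.domain = {t | 1 < t 0 ∧ t 0 < B} ∧ Set.EqOn rB.integrand (fun t => (t 0)⁻¹) rB.domain ∧
    12 * r3O.value + rEta.value * rA.value * rA.value - Real.pi * rN.value - c * (rA.value * rB.value) = 0 ∧
    d = (12 : ℤ) • KZ.of r3O + KZ.of rEta * KZ.of rA * KZ.of rA - KZ.of KZ.piRep * KZ.of rN
      - c • (KZ.of rA * KZ.of rB)}

/-- **Stub C statement (residual, conjecture-grade): completeness off the sector enlarged by the Haar elements.**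
Two rational-shape representations with equal values differ by an element of `relations ⊔ closure (T ∪ T_Haar)`.
Between `KZKernelConjecture` (`relations` alone) and the crux (`relations ⊔ closure T`); WEAKER than the crux
(`haarSectorComplete_of_torsionSectorComplete`). [cite: KontsevichZagier2001, §1.2 Conjecture 1] -/
def HaarSectorComplete : Prop := ∀ ⦃n m : ℕ⦄ (r : Literature.NumberTheory.Transcendental.KZ.IntegralRep n) (r' : Literature.NumberTheory.Transcendental.KZ.IntegralRep m), r.IsRational → r'.IsRational → r.value = r'.value → Literature.NumberTheory.Transcendental.KZ.of r - Literature.NumberTheory.Transcendental.KZ.of r' ∈ Literature.NumberTheory.Transcendental.KZ.relations ⊔ AddSubgroup.closure (TorsionTied ∪ HaarTied)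

/-! ### Registered stubs -/

/-- **Stub P (XL, load-bearing).** `HaarPrimitiveChainPos`. -/
theorem stub_haarChainPos : HaarPrimitiveChainPos := by
  sorry

/-- **Stub N (XL, load-bearing, hardest).** `HaarPrimitiveChainNeg`. -/
theorem stub_haarChainNeg : HaarPrimitiveChainNeg := by
  sorry

/-- **Stub C (residual, conjecture-grade).** `HaarSectorComplete`. -/
theorem stub_haarSectorComplete : HaarSectorComplete := by
  sorry

/-! ### Proved infrastructure (no `sorry` below this line) -/

/-- The crux unfolds to completeness relative to `relations ⊔ closure T`. -/
theorem torsionSectorComplete_iff :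
    TorsionSectorComplete ↔ ∀ ⦃n m : ℕ⦄ (r : Literature.NumberTheory.Transcendental.KZ.IntegralRep n) (r' : Literature.NumberTheory.Transcendental.KZ.IntegralRep m), r.IsRational → r'.IsRational → r.value = r'.value → Literature.NumberTheory.Transcendental.KZ.of r - Literature.NumberTheory.Transcendental.KZ.of r' ∈ Literature.NumberTheory.Transcendental.KZ.relations ⊔ AddSubgroup.closure TorsionTied :=
  Iff.rfl

/-- Member `false` is the floor, definitionally. -/
theorem member_false_iff : NeronHaarMember false ↔ NeronTorsionPrimitiveChain := Iff.rfl

/-- Member `true` is the Haar sector statement, definitionally. -/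
theorem member_true_iff : NeronHaarMember true ↔ NeronHaarSector := Iff.rfl

/-- The rung is the floor plus the new member. -/
theorem neronTorsionHaar_iff : NeronTorsionHaar ↔ NeronTorsionPrimitiveChain ∧ NeronHaarSector := by
  constructor
  · exact fun h => ⟨h false, h true⟩
  · rintro ⟨h₂, h₃⟩ (_ | _)
    · exact h₂
    · exact h₃

/-- **F3 WITNESS: the rung at the floor.** Member `false` is the CLOSED seed `NeronTorsionPrimitiveChain`
(`Cruxes.NeronTorsionSector.Translation.stub_assembly`, landed; route link `NeronTorsionPrimitiveChain_holds`). -/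
theorem rung_false : NeronHaarMember false := NeronTorsionPrimitiveChain_holds

/-- Transfer of the pinned one-dimensional representation `rA = [(e₁,∞), 1/√f]` to the real half-line integral
(`MeasurableEquiv.funUnique`, `volume_preserving_funUnique`). [folklore] -/
theorem value_rA {e₁ : ℝ} {f : ℝ → ℝ} (rA : KZ.IntegralRep 1) (hdA : rA.domain = {t | e₁ < t 0})
    (hiA : Set.EqOn rA.integrand (fun t => (Real.sqrt (f (t 0)))⁻¹) rA.domain) :
    rA.value = ∫ x in Set.Ioi e₁, (Real.sqrt (f x))⁻¹ := by
  rw [KZ.IntegralRep.value]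
  have hmeas : MeasurableSet rA.domain := by
    rw [hdA]
    exact measurableSet_lt measurable_const (measurable_pi_apply 0)
  rw [setIntegral_congr_fun hmeas hiA, hdA]
  have hpre : {t : Fin 1 → ℝ | e₁ < t 0} = MeasurableEquiv.funUnique (Fin 1) ℝ ⁻¹' Set.Ioi e₁ := by
    ext x
    simp [MeasurableEquiv.funUnique, Fin.default_eq_zero]
  rw [hpre]
  exact (volume_preserving_funUnique (Fin 1) ℝ).setIntegral_preimage_emb
    (MeasurableEquiv.funUnique (Fin 1) ℝ).measurableEmbedding (fun x => (Real.sqrt (f x))⁻¹) (Set.Ioi e₁)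

/-- **Bookkeeping: a primitive Haar chain at the given data gives the tied conclusion.**  Soundness of `relations` for
the chain's value, `ω₁/2 = rA.value > 0` (landed real dictionary), so the value hypothesis forces `c₀·log B₀ = c·log B`;
the landed log calculus gives `c₀•[rB₀] − c•[rB] ∈ relations`, the left-ideal property of `relations` in the product
calculus multiplies it by `[rA]`. [cite: KontsevichZagier2001, §1.2] [cite: Lang1983, Ch. 13 Thm 1.1] -/
theorem tied_of_primitive {g₂ g₃ e₁ B : ℝ} {c : ℤ} {f : ℝ → ℝ}
    (hf : ∀ x, f x = 4 * x ^ 3 - g₂ * x - g₃) (hdisc : g₂ ^ 3 - 27 * g₃ ^ 2 ≠ 0) (he : f e₁ = 0)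
    (hpos : ∀ x, e₁ < x → 0 < f x) (hB : 1 < B)
    (r3O : KZ.IntegralRep 3) (rEta rA rN rB : KZ.IntegralRep 1)
    (hdA : rA.domain = {t | e₁ < t 0}) (hiA : Set.EqOn rA.integrand (fun t => (Real.sqrt (f (t 0)))⁻¹) rA.domain)
    (hdB : rB.domain = {t | 1 < t 0 ∧ t 0 < B}) (hiB : Set.EqOn rB.integrand (fun t => (t 0)⁻¹) rB.domain)
    (hval : 12 * r3O.value + rEta.value * rA.value * rA.value - Real.pi * rN.value
      - c * (rA.value * rB.value) = 0)
    (hprim : ∃ (c : ℤ) (B : ℝ) (rB : KZ.IntegralRep 1), 1 < B ∧ IsAlgebraic ℚ B ∧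
      rB.domain = {t | 1 < t 0 ∧ t 0 < B} ∧ Set.EqOn rB.integrand (fun t => (t 0)⁻¹) rB.domain ∧
      (12 : ℤ) • KZ.of r3O + KZ.of rEta * KZ.of rA * KZ.of rA - KZ.of KZ.piRep * KZ.of rN
        - c • (KZ.of rA * KZ.of rB) ∈ KZ.relations) :
    (12 : ℤ) • KZ.of r3O + KZ.of rEta * KZ.of rA * KZ.of rA - KZ.of KZ.piRep * KZ.of rN
      - c • (KZ.of rA * KZ.of rB) ∈ KZ.relations := by
  obtain ⟨c₀, B₀, rB₀, hB₀, hB₀alg, hdB₀, hiB₀, hprim⟩ := hprim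
  have hvB₀ : rB₀.value = Real.log B₀ := logRep_value hB₀.le rB₀ hdB₀ hiB₀
  have hvB : rB.value = Real.log B := logRep_value hB.le rB hdB hiB
  have hBalg : IsAlgebraic ℚ B := isAlgebraic_of_logRep hB rB hdB
  have h0 : 12 * r3O.value + rEta.value * rA.value * rA.value - Real.pi * rN.value
      - c₀ * (rA.value * Real.log B₀) = 0 := by
    have h := KZ.relations_le_ker_eval_holds hprim
    rw [AddMonoidHom.mem_ker] at h
    simp only [map_add, map_sub, map_zsmul, KZ.eval_of, KZ.eval_mul', zsmul_eq_mul, hvB₀, KZ.piRep_value] at h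
    push_cast at h
    linear_combination h
  -- `rA.value = ω₁/2 > 0`
  have hApos : 0 < rA.value := by
    obtain ⟨ω, X, Y, hω, hωint, -⟩ := stub_realDictionary g₂ g₃ e₁ f hf hdisc he hpos
    rw [value_rA rA hdA hiA]
    linarith
  -- the value hypothesis becomes a relation between two logarithms of algebraic numbers
  have hlog : (c₀ : ℝ) * Real.log B₀ - c * Real.log B = 0 := by
    rw [hvB] at hval
    have hprod : ((c₀ : ℝ) * Real.log B₀ - c * Real.log B) * rA.value = 0 := by
      linear_combination hval - h0
    rcases mul_eq_zero.mp hprod with h | h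
    · exact h
    · exact absurd h hApos.ne'
  -- landed log calculus: `c₀•[rB₀] − c•[rB] ∈ relations`
  have hiB01 : Set.EqOn rB₀.integrand (fun t : Fin 1 → ℝ => 1 / t 0) rB₀.domain := fun t ht => by
    simp only [hiB₀ ht, one_div]
  have hiB1 : Set.EqOn rB.integrand (fun t : Fin 1 → ℝ => 1 / t 0) rB.domain := fun t ht => by
    simp only [hiB ht, one_div]
  have hL : c₀ • KZ.of rB₀ - c • KZ.of rB ∈ KZ.relations := by
    have h := interval_log_relation_mem_relations 2 ![1, 1] ![B₀, B] ![c₀, -c] ![rB₀, rB]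
      (fun i => by fin_cases i <;> simp)
      (fun i => by fin_cases i <;> simp [hB₀.le, hB.le])
      (fun i => by fin_cases i <;> exact isAlgebraic_one)
      (fun i => by fin_cases i <;> simp [hB₀alg, hBalg])
      (fun i => by
        fin_cases i
        · exact ⟨hdB₀, hiB01⟩
        · exact ⟨hdB, hiB1⟩)
      (by
        simp only [Fin.sum_univ_two, Matrix.cons_val_zero, Matrix.cons_val_one, div_one, Int.cast_neg]
        linear_combination hlog)
    have e : ∑ i : Fin 2, (![c₀, -c] i : ℤ) • KZ.of (![rB₀, rB] i) = c₀ • KZ.of rB₀ - c • KZ.of rB := by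
      simp only [Fin.sum_univ_two, Matrix.cons_val_zero, Matrix.cons_val_one, neg_smul]
      abel
    rw [e] at h
    exact h
  -- left-ideal property of `relations` in the product calculus
  have hAL : KZ.of rA * (c₀ • KZ.of rB₀ - c • KZ.of rB) ∈ KZ.relations := KZ.of_mul_mem_relations rA hL
  have hmul : KZ.of rA * (c₀ • KZ.of rB₀ - c • KZ.of rB) =
      c₀ • (KZ.of rA * KZ.of rB₀) - c • (KZ.of rA * KZ.of rB) := by
    rw [mul_sub, mul_smul_comm, mul_smul_comm]
  rw [hmul] at hAL
  -- assembly
  have e : (12 : ℤ) • KZ.of r3O + KZ.of rEta * KZ.of rA * KZ.of rA - KZ.of KZ.piRep * KZ.of rN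
      - c • (KZ.of rA * KZ.of rB) =
    ((12 : ℤ) • KZ.of r3O + KZ.of rEta * KZ.of rA * KZ.of rA - KZ.of KZ.piRep * KZ.of rN
      - c₀ • (KZ.of rA * KZ.of rB₀)) + (c₀ • (KZ.of rA * KZ.of rB₀) - c • (KZ.of rA * KZ.of rB)) := by
    abel
  rw [e]
  exact KZ.relations.add_mem hprim hAL

/-- **The tied member from the two primitive chains** (split on the sign of the discriminant). -/
theorem haarSector_of_primitiveChains (hP : HaarPrimitiveChainPos) (hN : HaarPrimitiveChainNeg) :
    NeronHaarSector := by
  intro g₂ g₃ e₁ B c f hf hdisc he he0 hpos hB r3O rEta rA rN rB hd3O hi3O hdEta hiEta hdA hiA hdN hiN hdB hiB hval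
  rcases lt_or_gt_of_ne (show g₂ ^ 3 - 27 * g₃ ^ 2 ≠ 0 from hdisc) with hlt | hgt
  · exact tied_of_primitive hf hdisc he hpos hB r3O rEta rA rN rB hdA hiA hdB hiB hval
      (hN g₂ g₃ e₁ f hf hlt he he0 hpos r3O rEta rA rN hd3O hi3O hdEta hiEta hdA hiA hdN hiN)
  · exact tied_of_primitive hf hdisc he hpos hB r3O rEta rA rN rB hdA hiA hdB hiB hval
      (hP g₂ g₃ e₁ f hf hgt he he0 hpos r3O rEta rA rN hd3O hi3O hdEta hiEta hdA hiA hdN hiN)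

/-- The rung from stubs P and N (the floor is a theorem). -/
theorem neronTorsionHaar_of (hP : HaarPrimitiveChainPos) (hN : HaarPrimitiveChainNeg) : NeronTorsionHaar :=
  neronTorsionHaar_iff.mpr ⟨NeronTorsionPrimitiveChain_holds, haarSector_of_primitiveChains hP hN⟩

/-- The Haar member says exactly `closure T_Haar ≤ KZ.relations`. [cite: KontsevichZagier2001, §1.2] -/
theorem closure_haarTied_le_relations (h : NeronHaarSector) :
    AddSubgroup.closure HaarTied ≤ Literature.NumberTheory.Transcendental.KZ.relations := by
  refine (AddSubgroup.closure_le _).mpr ?_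
  rintro d ⟨g₂, g₃, e₁, B, c, f, r3O, rEta, rA, rN, rB, hf, hdisc, he, he0, hpos, hB, hd3O, hi3O, hdEta, hiEta,
    hdA, hiA, hdN, hiN, hdB, hiB, hval, rfl⟩
  exact h g₂ g₃ e₁ B c f hf hdisc he he0 hpos hB r3O rEta rA rN rB hd3O hi3O hdEta hiEta hdA hiA hdN hiN hdB hiB
    hval

/-- The identity-component sector (the route's CLOSED sibling crux `NeronTorsionSector`, landed as
`NeronTorsionSector_of`) says exactly `closure T ≤ KZ.relations`. [cite: KontsevichZagier2001, §1.2] -/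
theorem closure_torsionTied_le_relations :
    AddSubgroup.closure TorsionTied ≤ Literature.NumberTheory.Transcendental.KZ.relations := by
  have h : NeronTorsionSector := NeronTorsionSector_of
  refine (AddSubgroup.closure_le _).mpr ?_
  rintro d ⟨g₂, g₃, e₁, xP, yP, α, N, a, M, k, m', f, rI, rP, rL, hf, hdisc, he, he0, hpos, hx, hy, hN, ha,
    ha', htie, hord, htor, hα, hdI, hiI, hdP, hiP, hdL, hiL, hval, rfl⟩
  exact h g₂ g₃ e₁ xP yP α N a M k m' f hf hdisc he he0 hpos hx hy hN ha ha' htie hord htor hα rI rP rL hdI hiI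
    hdP hiP hdL hiL hval

/-- **F4 ON-PATH, new member:** Conjecture 1 (kernel form, `kzKernelConjecture_iff_isRational`) gives the tied Haar
statement — the element evaluates (by `KZ.eval_mul'`, `KZ.piRep_value`) to the value hypothesis.  Tagged `@[simp]` so
that the tribunal's forward probe `S → Rung` closes. [cite: KontsevichZagier2001, §1.2] -/
@[simp] theorem haarSector_of_kontsevichZagierPeriods (h : _root_.KontsevichZagierPeriods) : NeronHaarSector := by
  have hK : KZKernelConjecture := kzKernelConjecture_iff_isRational.mpr h
  intro g₂ g₃ e₁ B c f _ _ _ _ _ _ r3O rEta rA rN rB _ _ _ _ _ _ _ _ _ _ hval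
  apply hK
  simp only [map_sub, map_add, map_zsmul, KZ.eval_mul', KZ.eval_of, KZ.piRep_value, zsmul_eq_mul]
  push_cast
  linear_combination hval

/-- **F4 ON-PATH LEMMA: the summit implies the rung** (member `false` is a theorem outright). -/
@[simp] theorem neronTorsionHaar_of_kontsevichZagierPeriods (h : _root_.KontsevichZagierPeriods) : NeronTorsionHaar :=
  neronTorsionHaar_iff.mpr ⟨NeronTorsionPrimitiveChain_holds, haarSector_of_kontsevichZagierPeriods h⟩

/-- The same, as an implication (the literal shape `S → Rung` of the forward probe). -/
theorem onPath : _root_.KontsevichZagierPeriods → NeronTorsionHaar :=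
  neronTorsionHaar_of_kontsevichZagierPeriods

/-- The residual is a consequence of the crux (hence of the summit): `closure T ≤ closure (T ∪ T_Haar)`.
(Informational: stub C is WEAKER than the crux as typed.) [folklore] -/
theorem haarSectorComplete_of_torsionSectorComplete (h : TorsionSectorComplete) : HaarSectorComplete := by
  intro n m r r' hr hr' hv
  have hmono : Literature.NumberTheory.Transcendental.KZ.relations ⊔ AddSubgroup.closure TorsionTied ≤
      Literature.NumberTheory.Transcendental.KZ.relations ⊔ AddSubgroup.closure (TorsionTied ∪ HaarTied) :=
    sup_le_sup_left (AddSubgroup.closure_mono Set.subset_union_left) _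
  exact hmono (torsionSectorComplete_iff.mp h r r' hr hr' hv)

/-! ### Composition: the crux BY NAME from the three stubs -/

/-- **`TorsionSectorComplete` from the stubs** (closed term; `sorry` only through `stub_haarChainPos`,
`stub_haarChainNeg` and `stub_haarSectorComplete`): the rung (stubs P, N) folds the Haar sector into the moves
(`closure T_Haar ≤ relations`), so the residual's `relations ⊔ closure (T ∪ T_Haar)` is `≤ relations ⊔ closure T`.
[cite: KontsevichZagier2001, §1.2] -/
theorem TorsionSectorComplete_of : TorsionSectorComplete := by
  suffices key : HaarPrimitiveChainPos → HaarPrimitiveChainNeg → HaarSectorComplete → TorsionSectorComplete from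
    key stub_haarChainPos stub_haarChainNeg stub_haarSectorComplete
  intro hP hN hC
  rw [torsionSectorComplete_iff]
  intro n m r r' hr hr' hv
  have hR : NeronHaarSector := haarSector_of_primitiveChains hP hN
  have hle : Literature.NumberTheory.Transcendental.KZ.relations ⊔ AddSubgroup.closure (TorsionTied ∪ HaarTied) ≤
      Literature.NumberTheory.Transcendental.KZ.relations ⊔ AddSubgroup.closure TorsionTied := by
    refine sup_le le_sup_left ((AddSubgroup.closure_le _).mpr ?_)
    rintro d (hd | hd)
    · exact AddSubgroup.mem_sup_right (AddSubgroup.subset_closure hd)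
    · exact AddSubgroup.mem_sup_left (closure_haarTied_le_relations hR (AddSubgroup.subset_closure hd))
  exact hle (hC r r' hr hr' hv)

end Summit.KontsevichZagierPeriods.KontsevichZagierPeriods.Cruxes.TorsionSectorComplete.NeronHaar

end
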